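import Mathlib

/-!
# Coefficients of a finite combination of `L²`-independent functions are bounded by its `L²` norm

Analysis/Approximation support file (everything proved, no definitions). Let `A_i, B_i`
(`i < m`) be continuous functions on `ℝ`, square-integrable on a half-line `(a, ∞)`, and assume
the `B`-family is linearly independent on `(a, ∞)` (a combination vanishing there has zero
coefficients). Then the quadratic form

  `Q(c) = ∫_{x>a} (Σ_i c_i A_i(x))² + (Σ_i c_i B_i(x))²`

dominates the coefficients: there is `Λ` with `Σ_i |c_i| ≤ Λ √Q(c)` for all `c`
(`exists_sum_abs_le_sqrt_integral`). Proof: `Q` is a positive definite quadratic form on `ℝ^m`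
(Gram matrix), continuous and positive on the compact `ℓ¹`-sphere, hence bounded below there by a
positive constant; homogeneity. Use: with `A_i = (x^{2i−n})'`, `B_i = √(n(n+1)) x^{2i−n−1}` (and
`A_i = 0`, `B_i = x^{2i−n}`) this is the "basis constant" of the even inverse powers spanning the
kernel data of the exact inverse-square channel estimate in the energy norm on `(1,∞)` — it turns
per-direction approximation of the exact kernel by the true one into approximation of the whole
kernel (route PhotonSphereChannels, `FixedModeChannels`, far side, stmt-FinalStateConjecture-10048).
Folklore (equivalence of norms on a finite-dimensional space).
-/

noncomputable section

namespace Literature.Analysis.Approximation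

open Set MeasureTheory Finset
open scoped _root_.Topology

/-- Products of square-integrable functions are integrable. [folklore] -/
theorem integrableOn_mul_of_sq {f g : ℝ → ℝ} (hf : Continuous f) (hg : Continuous g) {s : Set ℝ}
    (hf2 : IntegrableOn (fun x => f x ^ 2) s)
    (hg2 : IntegrableOn (fun x => g x ^ 2) s) : IntegrableOn (fun x => f x * g x) s := by
  refine Integrable.mono' ((hf2.add hg2).div_const 2) (hf.mul hg).aestronglyMeasurable
    (ae_of_all _ fun x => ?_)
  rw [Real.norm_eq_abs, abs_mul]
  show |f x| * |g x| ≤ (f x ^ 2 + g x ^ 2) / 2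
  nlinarith [sq_nonneg (|f x| - |g x|), sq_abs (f x), sq_abs (g x)]

/-- **Coefficient bound.** See the module docstring. [folklore] -/
theorem exists_sum_abs_le_sqrt_integral {m : ℕ} (A B : Fin m → ℝ → ℝ) (a : ℝ)
    (hA : ∀ i, Continuous (A i)) (hB : ∀ i, Continuous (B i))
    (hA2 : ∀ i, IntegrableOn (fun x => A i x ^ 2) (Ioi a))
    (hB2 : ∀ i, IntegrableOn (fun x => B i x ^ 2) (Ioi a))
    (hindep : ∀ c : Fin m → ℝ, (∀ x ∈ Ioi a, ∑ i, c i * B i x = 0) → c = 0) :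
    ∃ Λ : ℝ, 0 ≤ Λ ∧ ∀ c : Fin m → ℝ,
      IntegrableOn (fun x => (∑ i, c i * A i x) ^ 2 + (∑ i, c i * B i x) ^ 2) (Ioi a) ∧
      ∑ i, |c i| ≤ Λ * Real.sqrt (∫ x in Ioi a, ((∑ i, c i * A i x) ^ 2 + (∑ i, c i * B i x) ^ 2)) := by
  classical
  -- the Gram matrix and the quadratic form
  set G : Fin m → Fin m → ℝ := fun i j => ∫ x in Ioi a, (A i x * A j x + B i x * B j x) with hG
  have hprod : ∀ i j, IntegrableOn (fun x => A i x * A j x + B i x * B j x) (Ioi a) := fun i j =>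
    (integrableOn_mul_of_sq (hA i) (hA j) (hA2 i) (hA2 j)).add
      (integrableOn_mul_of_sq (hB i) (hB j) (hB2 i) (hB2 j))
  set Q : (Fin m → ℝ) → ℝ := fun c => ∑ i, ∑ j, c i * c j * G i j with hQ
  -- pointwise expansion of the integrand
  have hexpand : ∀ (c : Fin m → ℝ) (x : ℝ), (∑ i, c i * A i x) ^ 2 + (∑ i, c i * B i x) ^ 2
      = ∑ i, ∑ j, c i * c j * (A i x * A j x + B i x * B j x) := by
    intro c x
    rw [sq, sq, sum_mul_sum, sum_mul_sum, ← sum_add_distrib]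
    refine sum_congr rfl fun i _ => ?_
    rw [← sum_add_distrib]
    refine sum_congr rfl fun j _ => ?_
    ring
  have hterm_int : ∀ (c : Fin m → ℝ) i j,
      IntegrableOn (fun x => c i * c j * (A i x * A j x + B i x * B j x)) (Ioi a) :=
    fun c i j => (hprod i j).const_mul _
  have hint : ∀ c : Fin m → ℝ,
      IntegrableOn (fun x => (∑ i, c i * A i x) ^ 2 + (∑ i, c i * B i x) ^ 2) (Ioi a) := by
    intro c
    have : (fun x => (∑ i, c i * A i x) ^ 2 + (∑ i, c i * B i x) ^ 2)
        = fun x => ∑ i, ∑ j, c i * c j * (A i x * A j x + B i x * B j x) := funext (hexpand c)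
    rw [this]
    exact integrable_finsetSum _ fun i _ => integrable_finsetSum _ fun j _ => hterm_int c i j
  have hQeq : ∀ c : Fin m → ℝ,
      ∫ x in Ioi a, ((∑ i, c i * A i x) ^ 2 + (∑ i, c i * B i x) ^ 2) = Q c := by
    intro c
    simp_rw [hexpand c]
    rw [integral_finsetSum _ fun i _ => integrable_finsetSum _ fun j _ => hterm_int c i j]
    refine sum_congr rfl fun i _ => ?_
    rw [integral_finsetSum _ fun j _ => hterm_int c i j]
    refine sum_congr rfl fun j _ => ?_
    rw [integral_const_mul]
  -- basic properties of `Q`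
  have hQ0 : ∀ c, 0 ≤ Q c := fun c => by
    rw [← hQeq c]
    exact setIntegral_nonneg measurableSet_Ioi fun x _ => by positivity
  have hQcont : Continuous Q := by
    refine continuous_finsetSum _ fun i _ => continuous_finsetSum _ fun j _ => ?_
    exact ((continuous_apply i).mul (continuous_apply j)).mul continuous_const
  have hQsmul : ∀ (t : ℝ) (c : Fin m → ℝ), Q (t • c) = t ^ 2 * Q c := by
    intro t c
    simp only [hQ, Pi.smul_apply, smul_eq_mul, mul_sum]
    refine sum_congr rfl fun i _ => sum_congr rfl fun j _ => by ring
  have hQdef : ∀ c, Q c = 0 → c = 0 := by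
    intro c hc
    refine hindep c fun x hx => ?_
    -- the integrand vanishes on `Ioi a`
    have hf0 : ∀ y, 0 ≤ (∑ i, c i * A i y) ^ 2 + (∑ i, c i * B i y) ^ 2 := fun y => by positivity
    have hfc : Continuous fun y => (∑ i, c i * A i y) ^ 2 + (∑ i, c i * B i y) ^ 2 := by
      refine ((continuous_finsetSum _ fun i _ => continuous_const.mul (hA i)).pow 2).add
        ((continuous_finsetSum _ fun i _ => continuous_const.mul (hB i)).pow 2)
    have hae : (fun y => (∑ i, c i * A i y) ^ 2 + (∑ i, c i * B i y) ^ 2)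
        =ᵐ[volume.restrict (Ioi a)] 0 := by
      refine (integral_eq_zero_iff_of_nonneg (fun y => hf0 y) (hint c)).1 ?_
      rw [hQeq c, hc]
    have heq : EqOn (fun y => (∑ i, c i * A i y) ^ 2 + (∑ i, c i * B i y) ^ 2) 0 (Ioi a) :=
      Measure.eqOn_open_of_ae_eq hae isOpen_Ioi hfc.continuousOn continuousOn_const
    have h0 := heq hx
    simp only [Pi.zero_apply] at h0
    have hB0 : (∑ i, c i * B i x) ^ 2 = 0 := by
      have h1 := sq_nonneg (∑ i, c i * A i x)
      have h2 := sq_nonneg (∑ i, c i * B i x)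
      linarith
    exact eq_zero_of_pow_eq_zero (n := 2) hB0 |> fun h => by exact_mod_cast h
  ------------------------------------------------------------------
  -- the case `m = 0` and the compactness argument
  ------------------------------------------------------------------
  rcases Nat.eq_zero_or_pos m with hm | hm
  · subst hm
    refine ⟨0, le_rfl, fun c => ⟨hint c, ?_⟩⟩
    simp
  · -- the `ℓ¹` unit sphere is compact and nonempty
    set S : Set (Fin m → ℝ) := {c | ∑ i, |c i| = 1} with hS
    have hScl : IsClosed S :=
      isClosed_eq (continuous_finsetSum _ fun i _ => (continuous_apply i).abs) continuous_const
    have hSsub : S ⊆ Metric.closedBall (0 : Fin m → ℝ) 1 := by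
      intro c hc
      rw [Metric.mem_closedBall, dist_zero_right, pi_norm_le_iff_of_nonneg zero_le_one]
      intro i
      rw [Real.norm_eq_abs]
      have hc' : ∑ j, |c j| = 1 := hc
      calc |c i| ≤ ∑ j, |c j| := single_le_sum (fun j _ => abs_nonneg (c j)) (mem_univ i)
        _ = 1 := hc'
    have hScpt : IsCompact S := (isCompact_closedBall 0 1).of_isClosed_subset hScl hSsub
    have hSne : S.Nonempty := by
      refine ⟨Pi.single ⟨0, hm⟩ 1, ?_⟩
      show ∑ i, |(Pi.single (⟨0, hm⟩ : Fin m) (1 : ℝ) : Fin m → ℝ) i| = 1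
      rw [sum_eq_single (⟨0, hm⟩ : Fin m)]
      · simp
      · intro j _ hj
        rw [Pi.single_eq_of_ne hj, abs_zero]
      · intro h; exact absurd (Finset.mem_univ _) h
    obtain ⟨c₀, hc₀S, hc₀min⟩ := hScpt.exists_isMinOn hSne hQcont.continuousOn
    set μ : ℝ := Q c₀ with hμ
    have hμ0 : 0 < μ := by
      rcases lt_or_eq_of_le (hQ0 c₀) with h | h
      · exact h
      · exfalso
        have hc0 : c₀ = 0 := hQdef c₀ h.symm
        have : ∑ i, |c₀ i| = 1 := hc₀S
        rw [hc0] at this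
        simp at this
    refine ⟨1 / Real.sqrt μ, by positivity, fun c => ⟨hint c, ?_⟩⟩
    rw [hQeq c]
    set s : ℝ := ∑ i, |c i| with hs
    have hs0 : 0 ≤ s := sum_nonneg fun i _ => abs_nonneg _
    rcases eq_or_lt_of_le hs0 with hs00 | hspos
    · rw [← hs00]; positivity
    · -- normalise onto the sphere
      have hmem : s⁻¹ • c ∈ S := by
        show ∑ i, |(s⁻¹ • c) i| = 1
        simp only [Pi.smul_apply, smul_eq_mul, abs_mul, abs_inv, abs_of_pos hspos, ← mul_sum]
        exact inv_mul_cancel₀ hspos.ne'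
      have hmin : μ ≤ Q (s⁻¹ • c) := hc₀min hmem
      rw [hQsmul] at hmin
      -- `μ s² ≤ Q c`
      have hkey : μ * s ^ 2 ≤ Q c := by
        have h1 : μ * s ^ 2 ≤ (s⁻¹ ^ 2 * Q c) * s ^ 2 := mul_le_mul_of_nonneg_right hmin (sq_nonneg s)
        have h2 : (s⁻¹ ^ 2 * Q c) * s ^ 2 = Q c := by field_simp
        linarith
      have hsqrt : Real.sqrt μ * s ≤ Real.sqrt (Q c) := by
        rw [Real.le_sqrt (mul_nonneg (Real.sqrt_nonneg _) hs0) (hQ0 c), mul_pow,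
          Real.sq_sqrt hμ0.le]
        exact hkey
      have hsμ : 0 < Real.sqrt μ := Real.sqrt_pos.2 hμ0
      calc s = (1 / Real.sqrt μ) * (Real.sqrt μ * s) := by field_simp
        _ ≤ (1 / Real.sqrt μ) * Real.sqrt (Q c) := mul_le_mul_of_nonneg_left hsqrt (by positivity)

end Literature.Analysis.Approximation
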